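import Mathlib.Algebra.QuadraticAlgebra.Basic
import Mathlib.NumberTheory.Real.GoldenRatio
import Mathlib.NumberTheory.Real.Irrational
import Mathlib.Tactic
import HarnessLib

/-!
# Exact arithmetic in `ℤ[φ]` and `ℤ[φ][√τ]` (golden-ratio coordinates) with decidable sign

Topic `Literature/Computability/QuantumComplexity`; number-system infrastructure for the
`PromiseBQP`-hardness of the Jones polynomial at `t = e^{2πi/5}` (`flw_jonesApproxProblem_hard`,
`JonesInBQP.lean`). At `k = 5` every entry of the Aharonov–Jones–Landau path-model matrices lies in
the ring `ℤ[ζ₅, √τ]`, `τ = φ - 1 = φ⁻¹ = 2cos(2π/5)` (weights `λ₂/λ₁ = φ`, `λ₁/λ₂ = τ`,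
`√(λ₁λ₃)/λ₂ = √τ`, `A = ζ₅`; Aharonov–Jones–Landau 2009, §3.1 eq. (3.1) with `λ_ℓ = sin(πℓ/5)`),
and the braid compiler of the hardness reduction (Aharonov–Arad 2011, Thm. 3.2) has to compare
such numbers EXACTLY on a Turing machine. Following the tree's treatment of `ℤ[ω]`
(`ZWRing.lean`, `ZOmegaCodesFP.lean`: integer coordinates, evaluation into `ℂ`, a one-bit sign
test `0 < a + b√2` by squaring), this file provides the real part of that arithmetic:

* the coordinates are Mathlib's `QuadraticAlgebra R a b` (`ω² = a + bω`, a structure `⟨re, im⟩`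
  with `deriving DecidableEq` and a computable `CommRing` structure, so that `decide` evaluates
  closed terms); we only add `QuadraticAlgebra.liftHom f t`, the ring homomorphism into a
  commutative ring along a base map `f : R →+* S` at a root `t` of `t² = f a + f b · t` (the
  `RingHom` form of Mathlib's `QuadraticAlgebra.lift`, which wants an `Algebra R S` instance we do
  not register for the tower `ℤ[φ] → ℝ`), with its injectivity criterion;
* `ZPhi = QuadraticAlgebra ℤ 1 1 = ℤ[φ]` (`φ² = 1 + φ`), `ZPhi.toReal` (at the golden ratio), its
  injectivity (`φ` is irrational, Mathlib `Real.goldenRatio_irrational`), and the **decidable sign**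
  `ZPhi.pos` with `ZPhi.pos_iff : pos x = true ↔ 0 < toReal x`
  (`a + bφ = ((2a+b) + b√5)/2`, and `0 < x + y√5` is decided by the signs of `x, y` and of
  `x² - 5y²`);
* `ZPhiS = QuadraticAlgebra ZPhi τ 0 = ℤ[φ][√τ]`, `ZPhiS.toReal` (at `√τ = √(φ - 1)`), injectivity
  (`√τ ∉ ℚ(φ)`), and the decidable sign `ZPhiS.pos` with `ZPhiS.pos_iff` (same squaring trick one
  level up, using `ZPhi.pos`).

The complex level `ℤ[φ][ζ₅][√τ]` (`ζ₅² = τζ₅ - 1`) and the link to `ajlPoint 5`, `ajlWeight 5`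
are the sequel. Nothing here is specific to braids; no statements of results beyond these
algebraic facts are introduced, and everything is proved.

## References

* N. Bourbaki, *Algebra I*, Ch. III §2.3 (quadratic algebras `R[θ]/(θ² - bθ - a)`; Mathlib
  `QuadraticAlgebra`) [folklore].
* D. Aharonov, V. Jones, Z. Landau, Algorithmica 55 (2009); arXiv:quant-ph/0511096, §3.1
  [AharonovJonesLandau2009].
* D. Aharonov, I. Arad, New J. Phys. 13 (2011) 035019, Thm. 3.2 (efficiency of the braid compiler)
  [AharonovArad2011].
-/

namespace Literature.Computability.QuantumComplexity

/-! ### Ring homomorphisms out of `QuadraticAlgebra R a b` along a base map -/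

open QuadraticAlgebra

section LiftHom

variable {R S : Type*} [CommRing R] [CommRing S] {a b : R} (f : R →+* S) (t : S)

/-- **Evaluation at a root along a base map**: for `f : R →+* S` and `t ∈ S` with
`t² = f a + f b · t`, the map `⟨x, y⟩ ↦ f x + f y · t` is a ring homomorphism
`QuadraticAlgebra R a b → S` (universal property of `R[ω]/(ω² - bω - a)`). This is the `RingHom`
form of Mathlib's `QuadraticAlgebra.lift` (an `AlgHom` for an `[Algebra R S]` instance); a
deliberate dot-notation extension of the Mathlib structure, used along the tower
`ℤ[φ] → ℝ`, `ℤ[φ][√τ] → ℝ` without registering algebra instances on `ℝ`.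
(Bourbaki, *Algebra I*, III §2.3.) [folklore] -/
def _root_.QuadraticAlgebra.liftHom (ht : t * t = f a + f b * t) : QuadraticAlgebra R a b →+* S where
  toFun x := f x.re + f x.im * t
  map_one' := by simp
  map_mul' x y := by
    simp only [QuadraticAlgebra.re_mul, QuadraticAlgebra.im_mul, map_add, map_mul]
    linear_combination (-(f x.im * f y.im)) * ht
  map_zero' := by simp
  map_add' x y := by simp only [QuadraticAlgebra.re_add, QuadraticAlgebra.im_add, map_add]; ring

variable {f t}

/-- `liftHom` applied. [folklore] -/
@[simp] theorem _root_.QuadraticAlgebra.liftHom_apply (ht : t * t = f a + f b * t) (x : QuadraticAlgebra R a b) :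
    QuadraticAlgebra.liftHom f t ht x = f x.re + f x.im * t := rfl

/-- **Injectivity criterion**: if `f x + f y · t = 0` forces `x = y = 0` (i.e. `1, t` are
`f(R)`-linearly independent), `liftHom` is injective. [folklore] -/
theorem _root_.QuadraticAlgebra.liftHom_injective (ht : t * t = f a + f b * t)
    (hlin : ∀ x y : R, f x + f y * t = 0 → x = 0 ∧ y = 0) :
    Function.Injective (QuadraticAlgebra.liftHom f t ht) := by
  intro x y hxy
  have h0 : QuadraticAlgebra.liftHom f t ht (x - y) = 0 := by rw [map_sub, hxy, sub_self]
  rw [QuadraticAlgebra.liftHom_apply] at h0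
  obtain ⟨h1, h2⟩ := hlin _ _ h0
  rw [QuadraticAlgebra.re_sub, sub_eq_zero] at h1
  rw [QuadraticAlgebra.im_sub, sub_eq_zero] at h2
  exact QuadraticAlgebra.ext h1 h2

end LiftHom

/-! ### `ℤ[φ]`: the golden integers -/

/-- **`ℤ[φ] = ℤ[ω]/(ω² - ω - 1)`** in coordinates `x + yφ` (Mathlib `QuadraticAlgebra ℤ 1 1`,
`ω² = 1 + ω`). [folklore] -/
abbrev ZPhi : Type := QuadraticAlgebra ℤ 1 1

namespace ZPhi

open Real

/-- The golden ratio `φ = 0 + 1·φ` (Mathlib's `QuadraticAlgebra.omega`). [folklore] -/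
def phi : ZPhi := ⟨0, 1⟩

/-- `τ = φ - 1 = φ⁻¹ = 2cos(2π/5)`. [folklore] -/
def tau : ZPhi := ⟨-1, 1⟩

/-- Coordinates of `τ`. [folklore] -/
@[simp] theorem tau_re : tau.re = -1 := rfl
/-- Coordinates of `τ`. [folklore] -/
@[simp] theorem tau_im : tau.im = 1 := rfl

/-- **Evaluation `ℤ[φ] → ℝ` at the golden ratio** (`φ² = φ + 1`, Mathlib `Real.goldenRatio_sq`).
[folklore] -/
noncomputable def toReal : ZPhi →+* ℝ :=
  QuadraticAlgebra.liftHom (Int.castRingHom ℝ) goldenRatio (by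
    have h := goldenRatio_sq
    simp only [map_one, one_mul]
    nlinarith [h])

/-- `toReal` applied. [folklore] -/
theorem toReal_apply (x : ZPhi) : toReal x = (x.re : ℝ) + (x.im : ℝ) * goldenRatio := rfl

/-- `toReal τ = φ - 1`. [folklore] -/
theorem toReal_tau : toReal tau = goldenRatio - 1 := by
  rw [toReal_apply, tau_re, tau_im]; push_cast; ring

/-- `0 < toReal τ` (`φ > 1`). [folklore] -/
theorem toReal_tau_pos : 0 < toReal tau := by
  rw [toReal_tau]; linarith [one_lt_goldenRatio]

/-- `τ · φ = 1` in `ℤ[φ]`. [folklore] -/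
theorem tau_mul_phi : tau * phi = 1 := by decide

/-- **Integer linear independence of `1, t` for irrational `t`**: `a + b t = 0 ⇒ a = b = 0`.
[folklore] -/
theorem int_eq_zero_of_add_mul_irrational {t : ℝ} (ht : Irrational t) (a b : ℤ)
    (h : (a : ℝ) + (b : ℝ) * t = 0) : a = 0 ∧ b = 0 := by
  by_cases hb : b = 0
  · subst hb
    simp at h
    exact ⟨by exact_mod_cast h, rfl⟩
  · exfalso
    refine ht.ne_rat ((-a : ℚ) / b) ?_
    have hb' : (b : ℝ) ≠ 0 := by exact_mod_cast hb
    push_cast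
    rw [eq_div_iff hb']
    linarith

/-- The conjugate evaluation `ℤ[φ] → ℝ` at `ψ = (1 - √5)/2` (the other root of `θ² = θ + 1`,
Mathlib `Real.goldenConj_sq`). [folklore] -/
noncomputable def toConj : ZPhi →+* ℝ :=
  QuadraticAlgebra.liftHom (Int.castRingHom ℝ) goldenConj (by
    have h := goldenConj_sq
    simp only [map_one, one_mul]
    nlinarith [h])

/-- `toConj` applied. [folklore] -/
theorem toConj_apply (x : ZPhi) : toConj x = (x.re : ℝ) + (x.im : ℝ) * goldenConj := rfl

/-- `toConj τ = ψ - 1 < 0`. [folklore] -/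
theorem toConj_tau_neg : toConj tau < 0 := by
  rw [toConj_apply, tau_re, tau_im]; push_cast; linarith [goldenConj_neg]

/-- `toConj` is injective (`ψ` is irrational). [folklore] -/
theorem toConj_injective : Function.Injective toConj :=
  QuadraticAlgebra.liftHom_injective _ fun a b h =>
    int_eq_zero_of_add_mul_irrational goldenConj_irrational a b (by simpa using h)

/-- `toReal` is injective: equality in `ℝ` is decided on coordinates. [folklore] -/
theorem toReal_injective : Function.Injective toReal :=
  QuadraticAlgebra.liftHom_injective _ fun a b h =>
    int_eq_zero_of_add_mul_irrational goldenRatio_irrational a b (by simpa using h)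

/-- `toReal x = toReal y ↔ x = y`. [folklore] -/
theorem toReal_inj {x y : ZPhi} : toReal x = toReal y ↔ x = y := toReal_injective.eq_iff

/-! #### The sign of `x + y√5` and of `a + bφ` -/

/-- **One-bit sign test for `0 < x + y√5`** (`x, y ∈ ℤ`), by the signs of `x, y` and a comparison
of `x²` with `5y²`. (Knuth, TAOCP 2, §4.3.1-style exact comparison; the tree's `posSqrtTwoTest`
for `√2`.) [folklore] -/
def posSqrtFive (x y : ℤ) : Bool :=
  if 0 ≤ y then (if 0 ≤ x then decide (x ≠ 0 ∨ y ≠ 0) else decide (x * x < 5 * y * y))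
  else (if 0 < x then decide (5 * y * y < x * x) else false)

/-- `√5` is irrational, in the form used: `x² ≠ 5y²` unless `y = 0`. [folklore] -/
theorem sq_ne_five_mul_sq {x y : ℤ} (hy : y ≠ 0) : x * x ≠ 5 * y * y := by
  intro h
  have h5 : Irrational (Real.sqrt 5) := by
    simpa using Nat.Prime.irrational_sqrt (p := 5) (by norm_num)
  refine h5.ne_rat (|x| / |y| : ℚ) ?_
  have hyr : (0 : ℝ) < |(y : ℝ)| := abs_pos.2 (by exact_mod_cast hy)
  have h' : (x : ℝ) * x = 5 * y * y := by exact_mod_cast h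
  have hxy : (|(x : ℝ)| / |(y : ℝ)|) * (|(x : ℝ)| / |(y : ℝ)|) = 5 := by
    field_simp
    rw [sq_abs, sq_abs]
    linear_combination h'
  push_cast
  rw [← hxy, Real.sqrt_mul_self (by positivity)]

/-- **Correctness of the sign test**: `posSqrtFive x y ↔ 0 < x + y√5`. [folklore] -/
theorem posSqrtFive_iff (x y : ℤ) : posSqrtFive x y = true ↔ 0 < (x : ℝ) + (y : ℝ) * Real.sqrt 5 := by
  have h5 : (0 : ℝ) < Real.sqrt 5 := Real.sqrt_pos.2 (by norm_num)
  have hs : Real.sqrt 5 * Real.sqrt 5 = 5 := Real.mul_self_sqrt (by norm_num)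
  -- `(x + y√5)(x - y√5) = x² - 5y²`
  have key : ((x : ℝ) + y * Real.sqrt 5) * ((x : ℝ) - y * Real.sqrt 5) = (x : ℝ) * x - 5 * y * y := by
    linear_combination (-((y : ℝ) * y)) * hs
  unfold posSqrtFive
  by_cases hy : 0 ≤ y
  · rw [if_pos hy]
    have hy' : (0 : ℝ) ≤ y := by exact_mod_cast hy
    by_cases hx : 0 ≤ x
    · rw [if_pos hx, decide_eq_true_iff]
      have hx' : (0 : ℝ) ≤ x := by exact_mod_cast hx
      constructor
      · rintro (h | h)
        · have : (0 : ℝ) < x := by exact_mod_cast lt_of_le_of_ne hx (Ne.symm h)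
          nlinarith [mul_nonneg hy' h5.le]
        · have : (0 : ℝ) < y := by exact_mod_cast lt_of_le_of_ne hy (Ne.symm h)
          nlinarith [mul_pos this h5]
      · intro h
        by_contra hc
        push Not at hc
        obtain ⟨rfl, rfl⟩ := hc
        simp at h
    · rw [if_neg hx, decide_eq_true_iff]
      push Not at hx
      have hx' : (x : ℝ) < 0 := by exact_mod_cast hx
      constructor
      · intro h
        have h' : (x : ℝ) * x < 5 * y * y := by exact_mod_cast h
        -- `x < 0 ≤ y`, `x² < 5y²`: `y√5 > -x > 0`
        have hneg : (x : ℝ) - y * Real.sqrt 5 < 0 := by nlinarith [mul_nonneg hy' h5.le]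
        by_contra hc
        push Not at hc
        have : 0 ≤ ((x : ℝ) + y * Real.sqrt 5) * ((x : ℝ) - y * Real.sqrt 5) :=
          mul_nonneg_of_nonpos_of_nonpos hc hneg.le
        rw [key] at this
        linarith
      · intro h
        have hneg : (x : ℝ) - y * Real.sqrt 5 < 0 := by nlinarith [mul_nonneg hy' h5.le]
        have : ((x : ℝ) + y * Real.sqrt 5) * ((x : ℝ) - y * Real.sqrt 5) < 0 := mul_neg_of_pos_of_neg h hneg
        rw [key] at this
        have : (x * x - 5 * y * y : ℤ) < 0 := by exact_mod_cast this
        linarith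
  · rw [if_neg hy]
    push Not at hy
    have hy' : (y : ℝ) < 0 := by exact_mod_cast hy
    by_cases hx : 0 < x
    · rw [if_pos hx, decide_eq_true_iff]
      have hx' : (0 : ℝ) < x := by exact_mod_cast hx
      have hpos : 0 < (x : ℝ) - y * Real.sqrt 5 := by nlinarith [mul_neg_of_neg_of_pos hy' h5]
      constructor
      · intro h
        have h' : (5 : ℝ) * y * y < x * x := by exact_mod_cast h
        by_contra hc
        push Not at hc
        have : ((x : ℝ) + y * Real.sqrt 5) * ((x : ℝ) - y * Real.sqrt 5) ≤ 0 :=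
          mul_nonpos_of_nonpos_of_nonneg hc hpos.le
        rw [key] at this
        linarith
      · intro h
        have : 0 < ((x : ℝ) + y * Real.sqrt 5) * ((x : ℝ) - y * Real.sqrt 5) := mul_pos h hpos
        rw [key] at this
        have : (5 * y * y : ℤ) < x * x := by exact_mod_cast (by linarith : (5 : ℝ) * y * y < x * x)
        exact this
    · rw [if_neg hx]
      push Not at hx
      have hx' : (x : ℝ) ≤ 0 := by exact_mod_cast hx
      simp only [Bool.false_eq_true, false_iff, not_lt]
      nlinarith [mul_neg_of_neg_of_pos hy' h5]

/-- **Decidable sign on `ℤ[φ]`**: `pos (a + bφ)` tests `0 < (2a + b) + b√5` (`= 2(a + bφ)`).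
[folklore] -/
def pos (z : ZPhi) : Bool := posSqrtFive (2 * z.re + z.im) z.im

/-- `2 (a + bφ) = (2a + b) + b√5`. [folklore] -/
theorem two_mul_toReal (z : ZPhi) :
    2 * toReal z = ((2 * z.re + z.im : ℤ) : ℝ) + (z.im : ℝ) * Real.sqrt 5 := by
  rw [toReal_apply, goldenRatio]; push_cast; ring

/-- **Correctness of the sign on `ℤ[φ]`**: `pos z ↔ 0 < toReal z`. [folklore] -/
theorem pos_iff (z : ZPhi) : pos z = true ↔ 0 < toReal z := by
  rw [pos, posSqrtFive_iff, ← two_mul_toReal]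
  constructor
  · intro h; linarith
  · intro h; linarith

/-- `z < 0` in `ℝ` iff `pos (-z)`. [folklore] -/
theorem pos_neg_iff (z : ZPhi) : pos (-z) = true ↔ toReal z < 0 := by
  rw [pos_iff, map_neg, neg_pos]

/-- Decidable strict order test `x < y` on `ℤ[φ]` through `ℝ`. [folklore] -/
def lt (x y : ZPhi) : Bool := pos (y - x)

/-- Correctness of `lt`. [folklore] -/
theorem lt_iff (x y : ZPhi) : lt x y = true ↔ toReal x < toReal y := by
  rw [lt, pos_iff, map_sub, sub_pos]

end ZPhi

/-! ### `ℤ[φ][√τ]` -/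

/-- **`ℤ[φ][√τ] = ℤ[φ][ω]/(ω² - τ)`** in coordinates `x + y√τ`, `τ = φ - 1` (Mathlib
`QuadraticAlgebra ZPhi τ 0`, `ω² = τ`). [folklore] -/
abbrev ZPhiS : Type := QuadraticAlgebra ZPhi ZPhi.tau 0

namespace ZPhiS

open Real

/-- The real number `√τ = √(φ - 1)` (`= √(λ₁/λ₂)` at `k = 5`). [folklore] -/
noncomputable def sqrtTau : ℝ := Real.sqrt (goldenRatio - 1)

/-- `√τ · √τ = φ - 1`. [folklore] -/
theorem sqrtTau_mul_self : sqrtTau * sqrtTau = goldenRatio - 1 :=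
  Real.mul_self_sqrt (by linarith [one_lt_goldenRatio])

/-- `0 < √τ`. [folklore] -/
theorem sqrtTau_pos : 0 < sqrtTau := Real.sqrt_pos.2 (by linarith [one_lt_goldenRatio])

/-- **Evaluation `ℤ[φ][√τ] → ℝ`.** [folklore] -/
noncomputable def toReal : ZPhiS →+* ℝ :=
  QuadraticAlgebra.liftHom ZPhi.toReal sqrtTau (by rw [map_zero, zero_mul, add_zero, ZPhi.toReal_tau, sqrtTau_mul_self])

/-- `toReal` applied. [folklore] -/
theorem toReal_apply (z : ZPhiS) : toReal z = ZPhi.toReal z.re + ZPhi.toReal z.im * sqrtTau := rfl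

/-- **`√τ ∉ ℚ(φ)`**, in the form used: `ZPhi.toReal a + ZPhi.toReal b · √τ = 0 ⇒ a = b = 0`.
Squaring gives `a² = b²τ` in `ℤ[φ]`; under the conjugate embedding `φ ↦ ψ` the right-hand side is
`(b^ψ)² (ψ - 1) ≤ 0 ≤ (a^ψ)²`, so both vanish. [folklore] -/
theorem eq_zero_of_toReal_eq_zero_aux (a b : ZPhi)
    (h : ZPhi.toReal a + ZPhi.toReal b * sqrtTau = 0) : a = 0 ∧ b = 0 := by
  -- `a² = b² τ` in `ℤ[φ]`
  have hsq : a * a = b * b * ZPhi.tau := by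
    apply ZPhi.toReal_injective
    rw [map_mul, map_mul, map_mul, ZPhi.toReal_tau]
    have e : ZPhi.toReal a = -(ZPhi.toReal b * sqrtTau) := by linarith
    rw [e]
    linear_combination (ZPhi.toReal b * ZPhi.toReal b) * sqrtTau_mul_self
  -- conjugate embedding: squares are nonnegative, `ψ - 1 < 0`
  have hc := congrArg ZPhi.toConj hsq
  rw [map_mul, map_mul, map_mul] at hc
  have ht := ZPhi.toConj_tau_neg
  have hb0 : ZPhi.toConj b = 0 := by
    by_contra hb
    have hb2 : 0 < ZPhi.toConj b * ZPhi.toConj b := mul_self_pos.2 hb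
    nlinarith [mul_self_nonneg (ZPhi.toConj a), mul_neg_of_pos_of_neg hb2 ht]
  have hb : b = 0 := ZPhi.toConj_injective (by rw [hb0, map_zero])
  subst hb
  have ha0 : ZPhi.toConj a * ZPhi.toConj a = 0 := by rw [hc]; simp
  have ha : a = 0 := ZPhi.toConj_injective (by rw [mul_self_eq_zero.1 ha0, map_zero])
  exact ⟨ha, rfl⟩

/-- `toReal` is injective on `ℤ[φ][√τ]`. [folklore] -/
theorem toReal_injective : Function.Injective toReal :=
  QuadraticAlgebra.liftHom_injective _ fun a b h => eq_zero_of_toReal_eq_zero_aux a b h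

/-- `toReal x = toReal y ↔ x = y`. [folklore] -/
theorem toReal_inj {x y : ZPhiS} : toReal x = toReal y ↔ x = y := toReal_injective.eq_iff

/-- **Decidable sign on `ℤ[φ][√τ]`**: `0 < x + y√τ` by the signs of `x, y ∈ ℤ[φ]` (`ZPhi.pos`)
and a comparison of `x²` with `y²τ` in `ℤ[φ]`. [folklore] -/
def pos (z : ZPhiS) : Bool :=
  if ZPhi.pos (-z.im) then
    -- `y < 0`: need `x > 0` and `y²τ < x²`
    ZPhi.pos z.re && ZPhi.lt (z.im * z.im * ZPhi.tau) (z.re * z.re)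
  else
    -- `y ≥ 0`
    if ZPhi.pos (-z.re) then ZPhi.lt (z.re * z.re) (z.im * z.im * ZPhi.tau)
    else (ZPhi.pos z.re || ZPhi.pos z.im)

/-- **Correctness of the sign on `ℤ[φ][√τ]`**: `pos z ↔ 0 < toReal z`. [folklore] -/
theorem pos_iff (z : ZPhiS) : pos z = true ↔ 0 < toReal z := by
  obtain ⟨x, y⟩ := z
  have hs := sqrtTau_mul_self
  have hsp := sqrtTau_pos
  have htau := ZPhi.toReal_tau
  have eX2 : ZPhi.toReal (x * x) = ZPhi.toReal x * ZPhi.toReal x := by rw [map_mul]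
  have eY2 : ZPhi.toReal (y * y * ZPhi.tau) = ZPhi.toReal y * ZPhi.toReal y * (goldenRatio - 1) := by
    rw [map_mul, map_mul, htau]
  rw [toReal_apply]
  simp only [pos]
  set X := ZPhi.toReal x with hX
  set Y := ZPhi.toReal y with hY
  have key : (X + Y * sqrtTau) * (X - Y * sqrtTau) = X * X - Y * Y * (goldenRatio - 1) := by
    linear_combination (-(Y * Y)) * hs
  split_ifs with h1 h2
  · -- `Y < 0`
    rw [ZPhi.pos_neg_iff, ← hY] at h1
    rw [Bool.and_eq_true, ZPhi.pos_iff, ZPhi.lt_iff, eX2, eY2]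
    have hys : Y * sqrtTau < 0 := mul_neg_of_neg_of_pos h1 hsp
    constructor
    · rintro ⟨hx, h⟩
      have hpos : 0 < X - Y * sqrtTau := by linarith
      by_contra hc
      push Not at hc
      have : (X + Y * sqrtTau) * (X - Y * sqrtTau) ≤ 0 := mul_nonpos_of_nonpos_of_nonneg hc hpos.le
      nlinarith [key]
    · intro h
      have hx : 0 < X := by linarith
      have hpos : 0 < X - Y * sqrtTau := by linarith
      refine ⟨hx, ?_⟩
      have : 0 < (X + Y * sqrtTau) * (X - Y * sqrtTau) := mul_pos h hpos
      nlinarith [key]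
  · -- `0 ≤ Y`, `X < 0`
    rw [ZPhi.pos_neg_iff, ← hY, not_lt] at h1
    rw [ZPhi.pos_neg_iff, ← hX] at h2
    rw [ZPhi.lt_iff, eX2, eY2]
    have hneg : X - Y * sqrtTau < 0 := by nlinarith [mul_nonneg h1 hsp.le]
    constructor
    · intro h
      by_contra hc
      push Not at hc
      have : 0 ≤ (X + Y * sqrtTau) * (X - Y * sqrtTau) := mul_nonneg_of_nonpos_of_nonpos hc hneg.le
      nlinarith [key]
    · intro h
      have : (X + Y * sqrtTau) * (X - Y * sqrtTau) < 0 := mul_neg_of_pos_of_neg h hneg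
      nlinarith [key]
  · -- `0 ≤ Y`, `0 ≤ X`
    rw [ZPhi.pos_neg_iff, ← hY, not_lt] at h1
    rw [ZPhi.pos_neg_iff, ← hX, not_lt] at h2
    rw [Bool.or_eq_true, ZPhi.pos_iff, ZPhi.pos_iff]
    constructor
    · rintro (h | h)
      · nlinarith [mul_nonneg h1 hsp.le]
      · nlinarith [mul_pos h hsp]
    · intro h
      by_contra hc
      push Not at hc
      obtain ⟨hx, hy⟩ := hc
      have ex : X = 0 := le_antisymm hx h2
      have ey : Y = 0 := le_antisymm hy h1
      rw [ex, ey] at h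
      simp at h

/-- Decidable strict order test `x < y` on `ℤ[φ][√τ]` through `ℝ`. [folklore] -/
def lt (x y : ZPhiS) : Bool := pos (y - x)

/-- Correctness of `lt`. [folklore] -/
theorem lt_iff (x y : ZPhiS) : lt x y = true ↔ toReal x < toReal y := by
  rw [lt, pos_iff, map_sub, sub_pos]

end ZPhiS

end Literature.Computability.QuantumComplexity
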